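import Summits.BirchSwinnertonDyer.BirchSwinnertonDyer.Theorems.ByReductionTypeAtTwoOrdKatoHalfAtTwoIsoChebotarevTranspositionSignFree
import Summits.BirchSwinnertonDyer.BirchSwinnertonDyer.Theorems.ByReductionTypeAtTwoOrdKatoHalfAtTwoIsoSahDeeper
import Summits.BirchSwinnertonDyer.BirchSwinnertonDyer.Theorems.ByReductionTypeAtTwoOrdKatoHalfAtTwoIsoSahDeeperTorsion
import HarnessLib

/-!
# Route ByReductionTypeAtTwo, crux `OrdKatoHalfAtTwoIso` (stmt-BirchSwinnertonDyer-19573), line `steinberg-fibre-at-two`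
# (skeleton v11), stub `stub_coreA_posDisc : CoreTheoremAPosDiscTwo` (child 23967) — plan item (P3b): the sign-free Chebotarev step
# H-C⁺ INSIDE `Gal(ℚ̄/ℚ(μ_4))` — a transposition Frobenius `Fr` with `Fr ∈ rootsOfUnityFixer ℚ 4` (so `q ≡ 1 (mod 4)`)

Seat `cruxlead-stmt-BirchSwinnertonDyer-19573-g5` (LEAD PROVER, MODE LINE; HOME `run/shared/lean/pub/bsd-2adic/`; `--supports`
stmt-BirchSwinnertonDyer-19573 as helper). THEOREMS ONLY; nothing asserted; BSD is not proved by any of this; the crux and the stub are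
NOT proved here.

WHY. At `0 < Δ` the real component of the Kolyvagin class of a prime `q` vanishes only when `q ≡ 1 (mod 4)` (`…KolyvaginPackageTwoReal`,
p688788; at `q ≡ 3 (mod 4)` it equals the singular value). So the Chebotarev step must deliver Kolyvagin primes whose Frobenius lies in
`R4 = rootsOfUnityFixer ℚ 4` (then `4 ∣ ℓ − 1` by `four_dvd_sub_one_of_isArithFrobAt_of_mem_rootsOfUnityFixer`, p689168). This file re-runs
w2's sign-free step (p681540 §§1–2) VERBATIM with every group intersected with `R4`: §1 the bottom-cocycle producers now give witnesses in
`ker ρ̄₂ ⊓ ker κ ⊓ R4` (Steinberg–Sah with the deeper subgroup: `…SahDeeper`, `…SahDeeperTorsion`, p689500/p689668); §2 the Chebotarev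
argument with `G = ker ρ̄₂ ⊓ Gal(ℚ̄/ℚ_n) ⊓ R4` and a transposition `τ ∈ ker κ ∩ R4` (Rubin's `τ`, p682874: `τ·√−1 = √−1`) outputs IN
ADDITION `Fr ∈ R4` (`Fr = (Fr(aτ)⁻¹)·a·τ`, all three in `R4`). Nothing else changes (credit w2 / wave-3 / p662346 for the argument).

References: B. Mazur, K. Rubin, Mem. AMS 799 (2004) §3.6, Prop. 1.3.2 [MazurRubin2004]; J. Tate, GCFT (1967) §2.4 [TateGCFT1967];
C.-H. Sah 1968 Prop. 2.7 (b) [Sah1968]; tree p681540 (parent, verbatim), p689500, p689668, p682874, p689168.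
-/

set_option autoImplicit false
set_option linter.dupNamespace false

noncomputable section

open scoped NumberField
open Field WeierstrassCurve Function IsDedekindDomain NumberField
open Literature.NumberTheory.EllipticCurves Literature.NumberTheory.GaloisRepresentations
open Literature.NumberTheory.EllipticCurves.DokchitserDokchitser2012
open Summit.BirchSwinnertonDyer.BirchSwinnertonDyer.Rank1Residual

-- D-0017: single-problem summit, so `Summit.BirchSwinnertonDyer.BirchSwinnertonDyer.…` repeats a namespace BY DESIGN.
namespace Summit.BirchSwinnertonDyer.BirchSwinnertonDyer.Theorems.SteinbergFibreAtTwo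

/-- A transposition of three letters is an involution. [folklore] -/
private theorem perm_fin_three_mul_self_of_sign_eq_neg_one' :
    ∀ g : Equiv.Perm (Fin 3), Equiv.Perm.sign g = -1 → g * g = 1 := by
  decide

/-! ## §1 Bottom cocycles: non-vanishing witnesses in `ker ρ̄₂ ⊓ ker κ ⊓ Gal(ℚ̄/ℚ(μ_4))` -/

section BottomR4

variable (W : WeierstrassCurve ℚ) [W.IsElliptic] (κ : ZpExtension ℚ 2)

/-- **`φ₀ = (φ)₀` does not vanish on `ker ρ̄₂ ⊓ ker κ`** when `φ` represents `κ'_{J+1}` with `κ̄' ≠ 0` — for `κ`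
cyclotomic, `ρ̄_{E,2}` onto and `2Δ ∉ ℚ^{×2}` (either sign of `Δ`): the class of the bottom cocycle is `κ̄' ≠ 0`,
while a cocycle of `E[2]` vanishing there has zero class (sign-free Steinberg–Sah). Sign-free form of p662346 §5.
[cite: MazurRubin2004, §5.3] [cite: Sah1968, Prop. 2.7 (b)] -/
theorem exists_mem_inf_rootsOfUnityFixer_constCoeff_apply_ne_zero_of_towerConst_ne_zero (hκ : κ.IsCyclotomic)
    (h2 : W.HasSurjectiveModNGaloisRep 2) (hΔ : ¬ IsSquare (2 * W.Δ))
    (κ' : κ.twistTower (W.torsionGaloisModule (2 : ℤ))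
      (fun P : geomTorsion W (2 : ℤ) => AddSubgroup.torsionBy.nsmul P))
    (hκ' : κ.towerConst (W.torsionGaloisModule (2 : ℤ)) (fun P => AddSubgroup.torsionBy.nsmul P) κ' ≠ 0)
    (J : ℕ) (φ : contOneCocycles (W.modPTwist 2 κ (J + 1)).toTopRep)
    (hφ : oneCocycleClass (W.modPTwist 2 κ (J + 1)).toTopRep φ = κ'.1 (J + 1)) :
    ∃ ν ∈ (galoisRepTorsion W 2).ker ⊓ κ.kerSubgroup ⊓ rootsOfUnityFixer ℚ 4,
      (κ.pushCocycle (W.torsionGaloisModule (2 : ℤ))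
          (fun P : geomTorsion W (2 : ℤ) => AddSubgroup.torsionBy.nsmul P) (J + 1)
          (κ.twistModPConstCoeff (W.torsionGaloisModule (2 : ℤ))
            (fun P : geomTorsion W (2 : ℤ) => AddSubgroup.torsionBy.nsmul P) (J + 1) (Nat.succ_pos J)) φ).1 ν ≠ 0 := by
  by_contra hcon
  push Not at hcon
  have hc : galoisCohomology.map (κ.twistModPConstCoeff (W.torsionGaloisModule (2 : ℤ))
      (fun P : geomTorsion W (2 : ℤ) => AddSubgroup.torsionBy.nsmul P) (J + 1) (Nat.succ_pos J)) 1
      (κ'.1 (J + 1)) ≠ 0 := by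
    rw [LevelE.map_constCoeff_level_eq_towerConst]
    exact hκ'
  rw [← hφ] at hc
  change galoisCohomology.map _ 1 (oneCocycleClass (κ.twistModP (W.torsionGaloisModule (2 : ℤ))
    (fun P : geomTorsion W (2 : ℤ) => AddSubgroup.torsionBy.nsmul P) (J + 1)).toTopRep φ) ≠ 0 at hc
  rw [ZpExtension.map_oneCocycleClass_twist] at hc
  obtain ⟨σ₀, hσκ, hσ₀⟩ := exists_mem_kerSubgroup_noFixedPoint_of_isCyclotomic W κ hκ h2 hΔ
  exact hc (torsion_two_oneCocycleClass_eq_zero_of_forall_mem_inf_rootsOfUnityFixer_eq_zero_of_noFixedPoint W κ 4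
    hσκ hσ₀ _ hcon)

/-- **`ψ₀ = (ψ)₀` does not vanish on `ker ρ̄₂ ⊓ ker κ`** when `T^J[ψ] ≠ 0` in `H¹(ℚ, 𝒯_{J+1}(χ⁻¹))` — for `κ`
cyclotomic, `ρ̄_{E,2}` onto and `2Δ ∉ ℚ^{×2}` (either sign of `Δ`). Sign-free form of p662346 §5 (dual-twist
Steinberg–Sah). [cite: MazurRubin2004, §5.3] [cite: Sah1968, Prop. 2.7 (b)] -/
theorem exists_mem_inf_rootsOfUnityFixer_constCoeff_apply_ne_zero_of_shiftH1_iterate_ne_zero (hκ : κ.IsCyclotomic)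
    (h2 : W.HasSurjectiveModNGaloisRep 2) (hΔ : ¬ IsSquare (2 * W.Δ)) (J : ℕ)
    (ψ : contOneCocycles (W.modPTwist 2 κ.invTwist (J + 1)).toTopRep)
    (hψ : (κ.invTwist.shiftH1 (W.torsionGaloisModule (2 : ℤ))
        (fun P : geomTorsion W (2 : ℤ) => AddSubgroup.torsionBy.nsmul P) (J + 1))^[J]
      (oneCocycleClass (W.modPTwist 2 κ.invTwist (J + 1)).toTopRep ψ) ≠ 0) :
    ∃ ν ∈ (galoisRepTorsion W 2).ker ⊓ κ.kerSubgroup ⊓ rootsOfUnityFixer ℚ 4,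
      (κ.invTwist.pushCocycle (W.torsionGaloisModule (2 : ℤ))
          (fun P : geomTorsion W (2 : ℤ) => AddSubgroup.torsionBy.nsmul P) (J + 1)
          (κ.invTwist.twistModPConstCoeff (W.torsionGaloisModule (2 : ℤ))
            (fun P : geomTorsion W (2 : ℤ) => AddSubgroup.torsionBy.nsmul P) (J + 1) (Nat.succ_pos J)) ψ).1 ν ≠ 0 := by
  by_contra hcon
  push Not at hcon
  obtain ⟨σ₀, hσκ, hσ₀⟩ := exists_mem_kerSubgroup_noFixedPoint_of_isCyclotomic W κ hκ h2 hΔ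
  apply hψ
  change (κ.invTwist.shiftH1 (W.torsionGaloisModule (2 : ℤ))
      (fun P : geomTorsion W (2 : ℤ) => AddSubgroup.torsionBy.nsmul P) (J + 1))^[J]
    (oneCocycleClass (κ.invTwist.twistModP (W.torsionGaloisModule (2 : ℤ))
      (fun P : geomTorsion W (2 : ℤ) => AddSubgroup.torsionBy.nsmul P) (J + 1)).toTopRep ψ) = 0
  rw [ZpExtension.shiftH1_iterate_oneCocycleClass]
  have key : oneCocycleClass _ (κ.invTwist.shiftPowCocycle (W.torsionGaloisModule (2 : ℤ))
        (fun P : geomTorsion W (2 : ℤ) => AddSubgroup.torsionBy.nsmul P) (J + 1) J ψ) =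
      oneCocycleClass _ 0 :=
    invTwist_modPTwist_two_oneCocycleClass_eq_of_forall_mem_inf_rootsOfUnityFixer_eq_of_noFixedPoint W κ 4 hσκ hσ₀
      (J + 1) _ 0 fun ν hν => by
        rw [ZpExtension.shiftPowCocycle_apply]
        change _ = (0 : Fin (J + 1) → geomTorsion W (2 : ℤ))
        funext i
        rw [shiftEnd_pow_apply, Pi.zero_apply]
        by_cases hi : (i : ℕ) < J
        · rw [dif_pos hi]
        · rw [dif_neg hi]
          have hi2 := i.2
          have hfin : (⟨(i : ℕ) - J, by omega⟩ : Fin (J + 1)) = ⟨0, Nat.succ_pos J⟩ :=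
            Fin.ext (show (i : ℕ) - J = 0 by omega)
          rw [hfin]
          exact hcon ν hν
  exact key.trans (oneCocycleClass_zero _)

end BottomR4

/-! ## §2 (H-C) from a transposition `τ ∈ ker κ ∩ Gal(ℚ̄/ℚ(μ_4))`: a Frobenius fixing `μ_4` -/

section MainR4

variable (W : WeierstrassCurve ℚ) [W.IsElliptic] (κ : ZpExtension ℚ 2)

/-- **(H-C) on the bottom cocycles from a transposition `τ ∈ ker κ`.** For `ρ̄_{E,2}` onto, `τ ∈ ker κ` odd on
`{T₀, T₁, T₂}`, two continuous 1-cocycles `φ₀`, `ψ₀` of `E[2]` that do not vanish on `ker ρ̄₂ ⊓ ker κ`, an alternating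
non-degenerate pairing `e` on `E[2]`, a finite set `S` of places and `n : ℕ`: there is `q ∉ S` with a Frobenius `Fr`
above it which is a transposition on `E[2]`, lies in `Gal(ℚ̄/ℚ_n)`, and has `e((Fr − 1)φ₀(Fr), ψ₀(Fr)) ≠ 1`. Proof =
p662346's, with complex conjugation replaced by `τ` (a `3`-cycle in `ker κ` for the Steinberg–Sah step comes from `τ`
by p657099; `τ² = 1` is used only through its action on `E[2]`).
[cite: MazurRubin2004, §3.6 and Prop. 1.3.2] [cite: TateGCFT1967, §2.4 (Tchebotarev density theorem) with Prop. 2.3] -/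
theorem exists_isArithFrobAt_transposition_mem_rootsOfUnityFixer_weilPairingHom_ne_zero
    (h2 : W.HasSurjectiveModNGaloisRep 2) {τ : absoluteGaloisGroup ℚ} (hτκ : τ ∈ κ.kerSubgroup)
    (hτ4 : τ ∈ rootsOfUnityFixer ℚ 4)
    (hsign : Equiv.Perm.sign (permGal W (two_ne_zero : (2 : ℚ) ≠ 0) τ) = -1)
    (φ₀ ψ₀ : contOneCocycles (W.torsionGaloisModule (2 : ℤ)).toTopRep)
    (hφ₀ : ∃ ν ∈ (galoisRepTorsion W 2).ker ⊓ κ.kerSubgroup ⊓ rootsOfUnityFixer ℚ 4, φ₀.1 ν ≠ 0)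
    (hψ₀ : ∃ ν ∈ (galoisRepTorsion W 2).ker ⊓ κ.kerSubgroup ⊓ rootsOfUnityFixer ℚ 4, ψ₀.1 ν ≠ 0)
    (eW : geomTorsion W (2 : ℤ) → geomTorsion W (2 : ℤ) → AlgebraicClosure ℚ)
    (hμ : ∀ S T, eW S T ^ 2 = 1)
    (hadd₁ : ∀ S₁ S₂ T, eW (S₁ + S₂) T = eW S₁ T * eW S₂ T)
    (hadd₂ : ∀ S T₁ T₂, eW S (T₁ + T₂) = eW S T₁ * eW S T₂)
    (halt : ∀ T, eW T T = 1) (hnondeg : ∀ T, (∀ S, eW S T = 1) → T = 0)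
    (S : Set (HeightOneSpectrum (𝓞 ℚ))) (hS : S.Finite) (n : ℕ) :
    ∃ q : HeightOneSpectrum (𝓞 ℚ), q ∉ S ∧ ∃ 𝔓 ∈ q.primesAbove, ∃ Fr : absoluteGaloisGroup ℚ,
      IsArithFrobAt (𝓞 ℚ) Fr 𝔓 ∧ galoisRepTorsion W 2 Fr ≠ 1 ∧ galoisRepTorsion W 2 (Fr * Fr) = 1 ∧
      Fr ∈ κ.layerSubgroup n ∧ Fr ∈ rootsOfUnityFixer ℚ 4 ∧
      weilPairingHom W 2 eW hμ hadd₁ hadd₂ (Fr • φ₀.1 Fr - φ₀.1 Fr) (ψ₀.1 Fr) ≠ 0 := by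
  haveI : NeZero ((4 : ℕ) : ℚ) := ⟨by norm_num⟩
  haveI hR4n : (rootsOfUnityFixer ℚ 4).Normal := by
    rw [rootsOfUnityFixer_eq_ker]; exact MonoidHom.normal_ker _
  -- irreducibility of `E[2]` (from surjectivity)
  have hirr : ∀ B : AddSubgroup (geomTorsion W (2 : ℤ)),
      (∀ g : absoluteGaloisGroup ℚ, ∀ x ∈ B, g • x ∈ B) → B = ⊥ ∨ B = ⊤ :=
    hasIrreducibleModPGaloisRep_of_hasSurjectiveModNGaloisRep W 2 h2
  -- `τ` is a transposition in `ker κ`: `τ² = 1` on `E[2]`, a moved point, the fixed line; a 3-cycle in `ker κ`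
  have hττ : ∀ P : geomTorsion W 2, (τ * τ) • P = P :=
    (forall_smul_eq_iff_permGal_eq_one W (τ * τ)).mpr
      (by rw [permGal_mul]; exact perm_fin_three_mul_self_of_sign_eq_neg_one' _ hsign)
  have hne1 : permGal W two_ne_zero τ ≠ 1 := by
    intro h
    rw [h, Equiv.Perm.sign_one] at hsign
    exact absurd hsign (by decide)
  obtain ⟨x₀, hx₀⟩ : ∃ P : geomTorsion W 2, τ • P ≠ P := by
    by_contra h
    push Not at h
    exact hne1 ((forall_smul_eq_iff_permGal_eq_one W τ).mp h)
  obtain ⟨P, hP0, hcP, hℓ, -⟩ := exists_fixedPoint_of_sign_permGal_eq_neg_one W hsign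
  have hρc : galoisRepTorsion W 2 τ ≠ 1 := fun h =>
    hx₀ ((mem_ker_galoisRepTorsion_two_iff W τ).mp (MonoidHom.mem_ker.mpr h) x₀)
  obtain ⟨σ₀, hσ₀κ, hσ₀⟩ := exists_mem_kerSubgroup_forall_smul_ne W κ h2 hτκ hsign
  -- `G = ker ρ̄₂ ⊓ Gal(ℚ̄/ℚ_n)`: open, normal, acts trivially on `E[2]`
  set G : Subgroup (absoluteGaloisGroup ℚ) :=
    (galoisRepTorsion W 2).ker ⊓ κ.layerSubgroup n ⊓ rootsOfUnityFixer ℚ 4 with hG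
  haveI hGn0 : ((galoisRepTorsion W 2).ker ⊓ κ.layerSubgroup n).Normal := Subgroup.normal_inf_normal _ _
  haveI hGn : G.Normal := Subgroup.normal_inf_normal _ _
  have hGV : ∀ σ ∈ G, ∀ x : (W.torsionGaloisModule (2 : ℤ)).toTopRep,
      (W.torsionGaloisModule (2 : ℤ)).toTopRep.ρ σ x = x :=
    fun σ hσ x => (mem_ker_galoisRepTorsion_two_iff W σ).mp (Subgroup.mem_inf.mp (Subgroup.mem_inf.mp hσ).1).1 x
  have hGo : IsOpen (G : Set (absoluteGaloisGroup ℚ)) :=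
    ((W.isOpen_ker_galoisRepTorsion_holds (n := (2 : ℤ)) two_ne_zero).inter (κ.isOpen_layerSubgroup n)).inter
      (isOpen_rootsOfUnityFixer ℚ 4)
  have hNG : (galoisRepTorsion W 2).ker ⊓ κ.kerSubgroup ⊓ rootsOfUnityFixer ℚ 4 ≤ G :=
    inf_le_inf_right _ (inf_le_inf_left _ (κ.kerSubgroup_le_layerSubgroup n))
  -- the joint values `A = (φ₀, ψ₀)(G)`
  set A := contOneCocycles.jointValueSubgroup φ₀ ψ₀ G hGV hGV with hA
  have hAst : ∀ g : absoluteGaloisGroup ℚ, ∀ z ∈ A, (g • z.1, g • z.2) ∈ A :=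
    fun g z hz => contOneCocycles.smul_mem_jointValueSubgroup φ₀ ψ₀ G hGV hGV g hz
  obtain ⟨ν₁, hν₁, hφν₁⟩ := hφ₀
  obtain ⟨ν₂, hν₂, hψν₂⟩ := hψ₀
  have hA1 : ∃ z ∈ A, z.1 ≠ 0 := ⟨(φ₀.1 ν₁, ψ₀.1 ν₁), ⟨ν₁, hNG hν₁, rfl⟩, hφν₁⟩
  have hA2 : ∃ z ∈ A, z.2 ≠ 0 := ⟨(φ₀.1 ν₂, ψ₀.1 ν₂), ⟨ν₂, hNG hν₂, rfl⟩, hψν₂⟩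
  -- in the diagonal case `φ₀(τ) − ψ₀(τ) ∈ ℓ_τ` (Sah for `φ₀ − ψ₀`)
  have hdiag : (∀ z ∈ A, z.1 = z.2) → τ • (φ₀.1 τ - ψ₀.1 τ) = φ₀.1 τ - ψ₀.1 τ := by
    intro hd
    have h0 : oneCocycleClass _ (φ₀ - ψ₀) = 0 :=
      torsion_two_oneCocycleClass_eq_zero_of_forall_mem_inf_rootsOfUnityFixer_eq_zero_of_noFixedPoint W κ 4 hσ₀κ hσ₀
        (φ₀ - ψ₀)
        fun ν hν => by
          have := hd (φ₀.1 ν, ψ₀.1 ν) ⟨ν, hNG hν, rfl⟩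
          change φ₀.1 ν - ψ₀.1 ν = 0
          exact sub_eq_zero.mpr this
    obtain ⟨w, hw⟩ := (oneCocycleClass_eq_zero_iff _ _).mp h0
    have hwc : φ₀.1 τ - ψ₀.1 τ = τ • w - w := hw τ
    rw [hwc, smul_sub, ← mul_smul, hττ w, ← neg_sub (τ • w) w]
    exact neg_eq_self_geomTorsion_two W _
  -- the joint value `(φ₀ a, ψ₀ a)`, `a ∈ G`
  obtain ⟨z, hzA, hz1, hz2⟩ := exists_mem_stableProd_smul_add_ne hirr hP0 hcP hℓ A hAst hA1 hA2
    (φ₀.1 τ) (ψ₀.1 τ) hdiag hx₀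
  obtain ⟨a, haG, rfl⟩ := hzA
  dsimp only at hz1 hz2
  -- `σ := a τ`
  have haρ : a ∈ (galoisRepTorsion W 2).ker := (Subgroup.mem_inf.mp (Subgroup.mem_inf.mp haG).1).1
  have ha4 : a ∈ rootsOfUnityFixer ℚ 4 := (Subgroup.mem_inf.mp haG).2
  have hσn : a * τ ∈ κ.layerSubgroup n :=
    (κ.layerSubgroup n).mul_mem (Subgroup.mem_inf.mp (Subgroup.mem_inf.mp haG).1).2
      (κ.kerSubgroup_le_layerSubgroup n hτκ)
  have hρσ : galoisRepTorsion W 2 (a * τ) = galoisRepTorsion W 2 τ := by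
    rw [map_mul, MonoidHom.mem_ker.mp haρ, one_mul]
  have hφσ : φ₀.1 (a * τ) = φ₀.1 a + φ₀.1 τ := contOneCocycles.apply_mul_of_fixed φ₀ (hGV a haG) τ
  have hψσ : ψ₀.1 (a * τ) = ψ₀.1 a + ψ₀.1 τ := contOneCocycles.apply_mul_of_fixed ψ₀ (hGV a haG) τ
  have hσx : ∀ x : geomTorsion W (2 : ℤ), (a * τ) • x = τ • x := fun x => by
    rw [mul_smul, (mem_ker_galoisRepTorsion_two_iff W a).mp haρ]
  -- the open normal subgroup `N = {g ∈ G : φ₀ g = ψ₀ g = 0}`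
  obtain ⟨N, hNn, hNo, hNK, hNL, hNφ, hNψ⟩ :=
    JointValue.exists_normal_isOpen_le_forall_apply_eq_zero φ₀ ψ₀ G hGV hGV hGo (κ.layerSubgroup n)
      (κ.isOpen_layerSubgroup n) (isOpen_discrete _) (isOpen_discrete _)
  haveI := hNn
  -- Chebotarev at the class of `σ`
  obtain ⟨q, hqS, -, 𝔓, h𝔓, Fr, hFr, hFrσ⟩ :=
    exists_isArithFrobAt_mul_inv_mem_not_mem ℚ N hNo (a * τ) S hS
  -- transport along the coset `Fr = ν σ`, `ν ∈ N`
  have hνG : Fr * (a * τ)⁻¹ ∈ G := hNK hFrσ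
  have hFrν : Fr = Fr * (a * τ)⁻¹ * (a * τ) := by rw [inv_mul_cancel_right]
  have hρFr : galoisRepTorsion W 2 Fr = galoisRepTorsion W 2 τ := by
    rw [hFrν, map_mul, MonoidHom.mem_ker.mp (Subgroup.mem_inf.mp (Subgroup.mem_inf.mp hνG).1).1, one_mul, hρσ]
  have hφFr : φ₀.1 Fr = φ₀.1 (a * τ) := by
    rw [hFrν, contOneCocycles.apply_mul_of_fixed φ₀ (hGV _ hνG) (a * τ), hNφ _ hFrσ, zero_add]
  have hψFr : ψ₀.1 Fr = ψ₀.1 (a * τ) := by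
    rw [hFrν, contOneCocycles.apply_mul_of_fixed ψ₀ (hGV _ hνG) (a * τ), hNψ _ hFrσ, zero_add]
  have hFrx : ∀ x : geomTorsion W (2 : ℤ), Fr • x = τ • x := fun x => by
    rw [hFrν, mul_smul, hσx]
    exact (mem_ker_galoisRepTorsion_two_iff W _).mp (Subgroup.mem_inf.mp (Subgroup.mem_inf.mp hνG).1).1 (τ • x)
  have hτ1 : galoisRepTorsion W 2 (τ * τ) = 1 :=
    MonoidHom.mem_ker.mp ((mem_ker_galoisRepTorsion_two_iff W (τ * τ)).mpr hττ)
  refine ⟨q, hqS, 𝔓, h𝔓, Fr, hFr, ?_, ?_, ?_, ?_, ?_⟩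
  · rw [hρFr]
    exact hρc
  · rw [map_mul, hρFr, ← map_mul, hτ1]
  · rw [hFrν]
    exact (κ.layerSubgroup n).mul_mem (hNL hFrσ) hσn
  · -- NEW: `Fr = (Fr (aτ)⁻¹)·a·τ` with all three factors fixing `μ_4`
    rw [hFrν]
    exact (rootsOfUnityFixer ℚ 4).mul_mem (Subgroup.mem_inf.mp hνG).2 ((rootsOfUnityFixer ℚ 4).mul_mem ha4 hτ4)
  · rw [hφFr, hψFr, hFrx, hφσ, hψσ]
    exact weilPairingHom_two_smul_sub_ne_zero W eW hμ hadd₁ hadd₂ halt hnondeg hsign hz1 hz2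

end MainR4

end Summit.BirchSwinnertonDyer.BirchSwinnertonDyer.Theorems.SteinbergFibreAtTwo

end
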